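import Literature.Algebra.Homology.DoubleCosetsOrbitCorrespondence
import Literature.NumberTheory.NumberFields.PlacesAboveGaloisOrbits
import Literature.NumberTheory.GaloisRepresentations.SemiLocalUnits
import HarnessLib

/-!
# Every place of the fixed field `E^H` above `v` is `(π(s_t) · w̄)|_{E^H}` for a double coset
# `t ∈ U\Γ/φ(W)` (`π : Γ ↠ Gal(E/K)`, `π(U) ≤ H`, `π(φ(W))` fixing the place `w̄` of `E` above `v`)
# — Neukirch, *Algebraic Number Theory* I §9; Cassels–Fröhlich VII §1.1, Prop. 1.2 (ii)

Topic `NumberTheory/NumberFields`; namespace `Literature.NumberTheory.NumberFields.PlacesDoubleCosets`.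
Theorems and ONE definition with body (§2 `dcPlacesEquiv`, an `Equiv.ofBijective`); no named fact, no instance,
no notation, no `sorry`; number fields in `Type`.  Sequel of bsd-line-x1-p1-w5's `PlacesAboveGaloisOrbits` (the `H`-orbits of the places of `E` are
the places of `E^H`: `underFixedField_surjective`, `underFixedField_eq_iff`), door-c5's `SemiLocalUnits`
(the places `SemiLocal.Place K E v` of `E` above `v` as a TRANSITIVE `Gal(E/K)`-set: `Place.mulAction`,
`Place.exists_smul_eq`) and the group-theoretic engine `DoubleCosetsOrbitCorrespondence`
(`DiscreteRep.exists_apply_dcRep_smul_eq`: double cosets map onto the `H`-orbits of a transitive set).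

THE STATEMENT.  `E/K` a finite Galois extension of number fields with group `G = E ≃ₐ[K] E`, `H ≤ G`,
`L = E^H` (`IntermediateField.fixedField H`), `v` a finite place of `K`.  Let `π : Γ →* G` be a SURJECTIVE
homomorphism from any group `Γ` (in the application `Γ = G_S ↠ Gal(E/K)`), `U ≤ Γ` with `π(U) ≤ H`,
`φ : W →* Γ` any homomorphism (the decomposition map `φ_v : Γ_{K_v} → G_S`) and `w̄` a place of `E` above
`v` FIXED by `π(φ(W))` (`π ∘ φ_v` lands in the decomposition group `D_{w̄}`).  Then:

* `under_fixedField_smul`: `(h · w)|_L = w|_L` for `h ∈ H` and any finite place `w` of `E`;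
* **`exists_under_dcRep_smul_eq`**: for every finite place `u` of `L` above `v` there is a double coset
  `t ∈ U\Γ/φ(W)` with `(π(s_t) · w̄)|_L = u` (`s_t = dcRep φ U t` the chosen representatives) — «every
  place of `L` above `v` is a `u_t`»;
* `exists_under_dcRep_smul_eq'`: the same for `u` ranging over the places of `L` above a SET `S ∋ v`;
* §2 (the correspondence is a BIJECTION): `under_fixedField_eq_iff` (two places of `E` above `v` lie over the same
  place of `L` iff they are `H`-conjugate — transitivity of `Gal(E/L) = H` on the fibres), and, when moreover
  `U = π⁻¹(H)` and the stabiliser `G_{w̄}` of `w̄` is contained in `π(φ(W))`, the equivalence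
  **`dcPlacesEquiv : U\Γ/φ(W) ≃ {u : place of L | u ∣ v}`**, `t ↦ (π(s_t) · w̄)|_L` (`coe_dcPlacesEquiv_apply`), with
  `natCard_doubleCosets_eq` (`#(U\Γ/φ(W)) = #{u ∣ v}`) — Neukirch I §9: `H\G/G_𝔓 ↔ {primes of L = E^H above 𝔭}`.

USE: file P2-b (iii) of brick [P2-mono] of lane «PT-Ш-S-TC» (crux `GoodLatticeBDPValue`,
stmt-BirchSwinnertonDyer-19032, cell bsd-eis; bsd-line-x1-p1-w8's `eq_zero_of_forall_locLayerClass_eq_zero`):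
with `Γ = G_S`, `U` open normal, `E` a layer with `layerSubgroupS S E ≤ U`, `H = subgroupImageS S hE U`,
`w̄ = w̄_E` the place of `E` under the chosen `K̄ → K̄_w`, the local components `(w, t)` of a class in
`H²(U, Ī_S)` exhaust the places of `L = E^H` above `S` at which Tate's criterion (C–F VII Prop. 7.3) is
checked.  HONEST FRAMING: Galois/place bookkeeping; nothing about Poitou–Tate or BSD is proved here.
AI formalisation, established only by the kernel check.

## References
* J. Neukirch, *Algebraic Number Theory* (1999), Ch. I §9 (p. 54–55: transitivity on the primes above
  `𝔭`, decomposition groups `G_𝔓`, the double cosets `H\G/G_𝔓`). [NeukirchANT1999]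
* J. W. S. Cassels, A. Fröhlich (eds.), *Algebraic Number Theory* (1967), Ch. VII (J. Tate) §1.1 and
  Prop. 1.2 (ii). [CasselsFrohlichANT1967]
* J. S. Milne, *Fields and Galois Theory*, Thm. 3.16 (`H = Gal(E/E^H)`). [MilneFT2022]
-/

noncomputable section

open NumberField IsDedekindDomain MulAction
open Literature.NumberTheory.Automorphic Literature.Algebra.Homology.DiscreteRep
open Literature.NumberTheory.GaloisRepresentations

universe u

namespace Literature.NumberTheory.NumberFields

namespace PlacesDoubleCosets

variable {K E : Type} [Field K] [NumberField K] [Field E] [NumberField E] [Algebra K E]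

/-- **`(h · w)|_L = w|_L` for `h ∈ H`, `L = E^H`** (an element of `H = Gal(E/E^H)` does not move the place
below; tree `under_algEquiv_smul` over the base `E^H` + Mathlib's `subgroupEquivAlgEquiv`).
[cite: CasselsFrohlichANT1967, Ch. VII §1.1][cite: MilneFT2022, Thm. 3.16] -/
theorem under_fixedField_smul [FiniteDimensional K E] (H : Subgroup (E ≃ₐ[K] E)) {h : E ≃ₐ[K] E}
    (hh : h ∈ H) (w : HeightOneSpectrum (𝓞 E)) :
    (h • w).under (𝓞 (IntermediateField.fixedField H)) =
      w.under (𝓞 (IntermediateField.fixedField H)) := by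
  have e : h • w = IntermediateField.subgroupEquivAlgEquiv H ⟨h, hh⟩ • w := by
    rw [EquivariantSUnit.restrictScalars_smul_heightOneSpectrum (F := K),
      EquivariantSUnit.restrictScalars_subgroupEquivAlgEquiv]
  rw [e]
  exact HeightOneSpectrum.under_algEquiv_smul (IntermediateField.fixedField H) E _ _

variable [IsGalois K E]

/-- **Every place of `L = E^H` above `v` is `(π(s_t) · w̄)|_L` for some double coset `t ∈ U\Γ/φ(W)`**
(`π : Γ ↠ Gal(E/K)` surjective, `π(U) ≤ H`, `w̄` a place of `E` above `v` fixed by `π(φ(W))`): choose a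
place `w'` of `E` above `u`, move `w̄` to `w'` by transitivity of `Gal(E/K)` on the places above `v`, and
read the mover through `U\Γ/φ(W)` (`DiscreteRep.exists_apply_dcRep_smul_eq`).
[cite: NeukirchANT1999, Ch. I §9 (p. 54–55)][cite: CasselsFrohlichANT1967, Ch. VII Prop. 1.2 (ii)] -/
theorem exists_under_dcRep_smul_eq {Γ W : Type u} [Group Γ] [Group W] (φ : W →* Γ) (U : Subgroup Γ)
    (π : Γ →* (E ≃ₐ[K] E)) (hπ : Function.Surjective π) (H : Subgroup (E ≃ₐ[K] E))
    (hU : ∀ g ∈ U, π g ∈ H) {v : HeightOneSpectrum (𝓞 K)} (x₀ : SemiLocal.Place K E v)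
    (hφ : ∀ w : W, π (φ w) • x₀ = x₀)
    (u : HeightOneSpectrum (𝓞 (IntermediateField.fixedField H))) (hu : u.under (𝓞 K) = v) :
    ∃ t : DoubleCosets φ U,
      ((π (dcRep φ U t) • x₀ : SemiLocal.Place K E v) : HeightOneSpectrum (𝓞 E)).under
        (𝓞 (IntermediateField.fixedField H)) = u := by
  haveI : IsScalarTower K (IntermediateField.fixedField H) E :=
    IsScalarTower.of_algebraMap_eq fun _ => rfl
  -- a place `w'` of `E` above `u`; it lies above `v`
  haveI := u.isMaximal
  obtain ⟨P, hPm, hP⟩ := Ideal.exists_maximal_ideal_liesOver_of_isIntegral (S := 𝓞 E) u.asIdeal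
  have hP0 : P ≠ ⊥ := Ideal.ne_bot_of_liesOver_of_ne_bot u.ne_bot P
  have hw'u : (⟨P, hPm.isPrime, hP0⟩ : HeightOneSpectrum (𝓞 E)).under
      (𝓞 (IntermediateField.fixedField H)) = u := HeightOneSpectrum.ext hP.over.symm
  have hw'v : (⟨P, hPm.isPrime, hP0⟩ : HeightOneSpectrum (𝓞 E)).under (𝓞 K) = v := by
    rw [← HeightOneSpectrum.under_under K (IntermediateField.fixedField H) E, hw'u, hu]
  -- transitivity of `Gal(E/K)` on the places above `v` (door-c5 `Place.exists_smul_eq`)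
  haveI : MulAction.IsPretransitive (E ≃ₐ[K] E) (SemiLocal.Place K E v) :=
    ⟨fun w w' => SemiLocal.Place.exists_smul_eq w w'⟩
  obtain ⟨t, ht⟩ := exists_apply_dcRep_smul_eq φ π
    (f := fun w : SemiLocal.Place K E v =>
      (w : HeightOneSpectrum (𝓞 E)).under (𝓞 (IntermediateField.fixedField H)))
    (fun h hh w => under_fixedField_smul H hh (w : HeightOneSpectrum (𝓞 E))) hπ hU hφ
    (⟨⟨P, hPm.isPrime, hP0⟩, hw'v⟩ : SemiLocal.Place K E v)
  exact ⟨t, ht.trans hw'u⟩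

/-- The same with `u` ranging over the places of `L = E^H` above a set `S` of places of `K`: for each such
`u` (above `v := u ∩ 𝓞 K ∈ S`) and each choice of base place `w̄_v` fixed by `π(φ_v(W_v))`, some double
coset `t ∈ U\Γ/φ_v(W_v)` has `(π(s_t) · w̄_v)|_L = u`.
[cite: NeukirchANT1999, Ch. I §9 (p. 54–55)][cite: CasselsFrohlichANT1967, Ch. VII Prop. 1.2 (ii)] -/
theorem exists_under_dcRep_smul_eq' {Γ : Type u} [Group Γ] (U : Subgroup Γ)
    (π : Γ →* (E ≃ₐ[K] E)) (hπ : Function.Surjective π) (H : Subgroup (E ≃ₐ[K] E))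
    (hU : ∀ g ∈ U, π g ∈ H) {S : Set (HeightOneSpectrum (𝓞 K))}
    {W : HeightOneSpectrum (𝓞 K) → Type u} [∀ v, Group (W v)] (φ : ∀ v, W v →* Γ)
    (x₀ : ∀ v, SemiLocal.Place K E v) (hφ : ∀ v ∈ S, ∀ w : W v, π (φ v w) • x₀ v = x₀ v)
    (u : HeightOneSpectrum (𝓞 (IntermediateField.fixedField H))) (hu : u.under (𝓞 K) ∈ S) :
    ∃ t : DoubleCosets (φ (u.under (𝓞 K))) U,
      ((π (dcRep (φ (u.under (𝓞 K))) U t) • x₀ (u.under (𝓞 K)) :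
          SemiLocal.Place K E (u.under (𝓞 K))) : HeightOneSpectrum (𝓞 E)).under
        (𝓞 (IntermediateField.fixedField H)) = u :=
  exists_under_dcRep_smul_eq (φ (u.under (𝓞 K))) U π hπ H hU (x₀ _) (hφ _ hu) u rfl

/-! ## §2. The correspondence `U\Γ/φ(W) ↔ {places of L above v}` is a bijection -/

/-- **Two places of `E` above `v` lie over the same place of `L = E^H` iff they are `H`-conjugate** (transitivity of
`Gal(E/E^H)` on the places above a place of `E^H`, tree `HeightOneSpectrum.exists_algEquiv_smul_eq`, and `H = Gal(E/E^H)`,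
Mathlib `IntermediateField.subgroupEquivAlgEquiv`). [cite: CasselsFrohlichANT1967, Ch. VII Prop. 1.2 (ii)][cite: MilneFT2022, Thm. 3.16] -/
theorem under_fixedField_eq_iff (H : Subgroup (E ≃ₐ[K] E)) {v : HeightOneSpectrum (𝓞 K)} (w w' : SemiLocal.Place K E v) :
    (w : HeightOneSpectrum (𝓞 E)).under (𝓞 (IntermediateField.fixedField H)) =
        (w' : HeightOneSpectrum (𝓞 E)).under (𝓞 (IntermediateField.fixedField H)) ↔
      ∃ h ∈ H, h • w' = w := by
  constructor
  · intro e
    obtain ⟨σ, hσ⟩ := HeightOneSpectrum.exists_algEquiv_smul_eq (IntermediateField.fixedField H) (E := E)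
      (w := (w' : HeightOneSpectrum (𝓞 E))) (w' := (w : HeightOneSpectrum (𝓞 E))) e.symm
    refine ⟨((IntermediateField.subgroupEquivAlgEquiv H).symm σ : H),
      ((IntermediateField.subgroupEquivAlgEquiv H).symm σ).2, SemiLocal.Place.ext ?_⟩
    rw [SemiLocal.Place.coe_smul, EquivariantSUnit.coe_subgroupEquivAlgEquiv_symm,
      ← EquivariantSUnit.restrictScalars_smul_heightOneSpectrum, hσ]
  · rintro ⟨h, hh, rfl⟩
    rw [SemiLocal.Place.coe_smul]
    exact under_fixedField_smul H hh _

omit [IsGalois K E] in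
/-- The place of `L` below `π(x) · w̄` lies above `v`. [cite: CasselsFrohlichANT1967, Ch. VII §1.1] -/
theorem under_under_smul_eq (H : Subgroup (E ≃ₐ[K] E)) {v : HeightOneSpectrum (𝓞 K)} (g : E ≃ₐ[K] E)
    (x₀ : SemiLocal.Place K E v) :
    (((g • x₀ : SemiLocal.Place K E v) : HeightOneSpectrum (𝓞 E)).under
        (𝓞 (IntermediateField.fixedField H))).under (𝓞 K) = v := by
  haveI : IsScalarTower K (IntermediateField.fixedField H) E := IsScalarTower.of_algebraMap_eq fun _ => rfl
  rw [HeightOneSpectrum.under_under K (IntermediateField.fixedField H) E]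
  exact (g • x₀).under_eq

/-- **The bijection `U\Γ/φ(W) ≃ {places of L = E^H above v}`, `t ↦ (π(s_t) · w̄)|_L`**, for `π : Γ ↠ Gal(E/K)`,
`U = π⁻¹(H)`, `w̄` a place of `E` above `v` fixed by `π(φ(W))` whose stabiliser `G_{w̄}` is contained in `π(φ(W))`
(so `π(φ(W)) = G_{w̄}`): Neukirch's `H\G/G_𝔓 ↔ {𝔓' ∣ 𝔭 in L}` (surjective by `exists_under_dcRep_smul_eq`, injective by
`under_fixedField_eq_iff` and `DiscreteRep.dcOrbitMap_injective`).
[cite: NeukirchANT1999, Ch. I §9 (p. 54–55)][cite: CasselsFrohlichANT1967, Ch. VII Prop. 1.2 (ii)] -/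
def dcPlacesEquiv {Γ W : Type u} [Group Γ] [Group W] (φ : W →* Γ) (U : Subgroup Γ)
    (π : Γ →* (E ≃ₐ[K] E)) (hπ : Function.Surjective π) (H : Subgroup (E ≃ₐ[K] E)) (hUH : U = H.comap π)
    {v : HeightOneSpectrum (𝓞 K)} (x₀ : SemiLocal.Place K E v) (hφ : ∀ w : W, π (φ w) • x₀ = x₀)
    (hstab : ∀ g : E ≃ₐ[K] E, g • x₀ = x₀ → ∃ w : W, π (φ w) = g) :
    DoubleCosets φ U ≃ {u : HeightOneSpectrum (𝓞 (IntermediateField.fixedField H)) // u.under (𝓞 K) = v} :=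
  Equiv.ofBijective
    (fun t => ⟨((π (dcRep φ U t) • x₀ : SemiLocal.Place K E v) : HeightOneSpectrum (𝓞 E)).under
      (𝓞 (IntermediateField.fixedField H)), under_under_smul_eq H _ x₀⟩)
    (by
      have hU : ∀ g ∈ U, π g ∈ H := fun g hg => by
        rw [hUH, Subgroup.mem_comap] at hg
        exact hg
      refine ⟨fun t₁ t₂ h12 => ?_, fun u => ?_⟩
      · -- same place of `L` below ⇒ `H`-conjugate ⇒ same `H`-orbit ⇒ same double coset
        have h12' := congrArg Subtype.val h12
        obtain ⟨h, hh, e⟩ := (under_fixedField_eq_iff H _ _).1 h12'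
        refine dcOrbitMap_injective φ π (H := H) (x₀ := x₀) hUH hφ hstab ?_
        rw [dcOrbitMap_apply, dcOrbitMap_apply]
        refine Quotient.sound ?_
        change _ ∈ MulAction.orbit (↥H) _
        rw [MulAction.mem_orbit_iff]
        exact ⟨⟨h, hh⟩, e⟩
      · obtain ⟨t, ht⟩ := exists_under_dcRep_smul_eq φ U π hπ H hU x₀ hφ u.1 u.2
        exact ⟨t, Subtype.ext ht⟩)

/-- Formula: `dcPlacesEquiv t = (π(s_t) · w̄)|_L`. [cite: NeukirchANT1999, Ch. I §9 (p. 54–55)] -/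
@[simp] theorem coe_dcPlacesEquiv_apply {Γ W : Type u} [Group Γ] [Group W] (φ : W →* Γ) (U : Subgroup Γ)
    (π : Γ →* (E ≃ₐ[K] E)) (hπ : Function.Surjective π) (H : Subgroup (E ≃ₐ[K] E)) (hUH : U = H.comap π)
    {v : HeightOneSpectrum (𝓞 K)} (x₀ : SemiLocal.Place K E v) (hφ : ∀ w : W, π (φ w) • x₀ = x₀)
    (hstab : ∀ g : E ≃ₐ[K] E, g • x₀ = x₀ → ∃ w : W, π (φ w) = g) (t : DoubleCosets φ U) :
    ((dcPlacesEquiv φ U π hπ H hUH x₀ hφ hstab t :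
        {u : HeightOneSpectrum (𝓞 (IntermediateField.fixedField H)) // u.under (𝓞 K) = v}) :
        HeightOneSpectrum (𝓞 (IntermediateField.fixedField H))) =
      ((π (dcRep φ U t) • x₀ : SemiLocal.Place K E v) : HeightOneSpectrum (𝓞 E)).under
        (𝓞 (IntermediateField.fixedField H)) := rfl

/-- **`#(U\Γ/φ(W)) = #{places of L above v}`.** [cite: NeukirchANT1999, Ch. I §9 (p. 54–55)] -/
theorem natCard_doubleCosets_eq {Γ W : Type u} [Group Γ] [Group W] (φ : W →* Γ) (U : Subgroup Γ)
    (π : Γ →* (E ≃ₐ[K] E)) (hπ : Function.Surjective π) (H : Subgroup (E ≃ₐ[K] E)) (hUH : U = H.comap π)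
    {v : HeightOneSpectrum (𝓞 K)} (x₀ : SemiLocal.Place K E v) (hφ : ∀ w : W, π (φ w) • x₀ = x₀)
    (hstab : ∀ g : E ≃ₐ[K] E, g • x₀ = x₀ → ∃ w : W, π (φ w) = g) :
    Nat.card (DoubleCosets φ U) =
      Nat.card {u : HeightOneSpectrum (𝓞 (IntermediateField.fixedField H)) // u.under (𝓞 K) = v} :=
  Nat.card_congr (dcPlacesEquiv φ U π hπ H hUH x₀ hφ hstab)

end PlacesDoubleCosets

end Literature.NumberTheory.NumberFields

end
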